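import Mathlib
import Literature.NumberTheory.Transcendental.BakerLinearFormsQuantitativeProofs
import Literature.Barriers.Schanuel.LargeTranscendenceDegreeHolds
import Literature.Barriers.Schanuel.LargeTranscendenceDegreeProofs
import Literature.NumberTheory.Transcendental.DiazGrid
import Summits.Schanuel.Schanuel.Theorems.RigidCoreSchanuelOnLogFreeCorePiPowersTH
import Summits.Schanuel.Schanuel.Theorems.RigidCoreSchanuelOnLogFreeCoreCalibrationR

/-!
# The Technical Hypothesis for the real powers of `π` (stub `stub_piRealPowersTH`, C14)

Registered calibration stub `stub_piRealPowersTH` (C14) of line `sector-split` of crux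
`stmt-Schanuel-0970` (`Summit.Schanuel.Schanuel.Theses.RigidCore.SchanuelOnLogFreeCore`).  It is
the real-`π` companion of the landed `stub_piPowersTH` (powers of `τ = 2πi`,
`RigidCoreSchanuelOnLogFreeCorePiPowersTH.lean`), and is off the path to the crux.  We prove,
unconditionally:

* `PiRealPowersTH.exists_rootDist_lowerBound` — **a transcendence measure for `π`, root form**:
  for every `d ≥ 1` there is `k` such that for every non-zero `P ∈ ℤ[X]` of degree `≤ d` and
  height `≤ H` (`H ≥ 1`) and every complex root `ρ` of `P`, `|π − ρ| > (2H)^{-k}`.  This is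
  A. Baker, *Transcendental Number Theory* (1975), Ch. 3, Theorem 3.1 with `n = 1`, `α₁ = -1`,
  `log α₁ = πi`, `β₁ = i`, `β₀ = ρ` (so that `β₀ + β₁ πi = ρ − π`; "more especially
  `|π − β| > B^{-C}`", loc. cit. p. 28), read off the tree's PROVED
  `Literature.NumberTheory.Transcendental.baker1975_thm_3_1_holds` through its corollary
  `baker1975_thm_3_1.pi_case` (in degree `max d 2`, the witness of `i` being `X² + 1`); the
  alternative `ρ − π = 0` is excluded by Lindemann (`transcendental_pi_holds`, in the complex
  form `CalibrationR.transcendental_pi_complex`).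
* `PiRealPowersTH.norm_aeval_pi_lowerBound` — the classical **transcendence measure of `π` in
  fixed degree** (Baker 1975 p. 28; N. I. Fel'dman 1960): for every `d` there are `c > 0` and `k`
  with `c ≤ (∑ᵢ |hᵢ|)^k · |∑_{i<d} hᵢ πⁱ|` for all non-zero `h ∈ ℤ^d` — from the root bound by
  multiplying over the complex roots of `P_h = ∑ hᵢ Xⁱ` (`|P_h(π)| = |lead| · ∏_ρ |π − ρ|`), with
  the polynomial bookkeeping of `KernelTower.*` (imported).
* `PiRealPowersTH.linearIndependent_pi_pow` — the powers `1, π, …, π^{d-1}` are `ℚ`-linearly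
  independent (Lindemann).
* `stub_piRealPowersTH` (signature verbatim) — the **Technical Hypothesis** (Yu. V. Nesterenko,
  P. Philippon (eds.), LNM 1752 (2001), Ch. 14, Definition 2.6) for `(1, π, …, π^{d-1})`, by the
  tree's `TechnicalHypothesis.of_lowerBound` (a polynomial lower bound implies (T.H.)).

No definition is introduced; auxiliaries live in the sub-namespace `…RigidCore.PiRealPowersTH`,
only the registered stub is declared directly in `Summit.Schanuel.Schanuel.Theorems.RigidCore`.

## References

* A. Baker, *Transcendental Number Theory*, Cambridge University Press (1975), Ch. 3, Theorem 3.1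
  (p. 27) and the corollary `|π − β| > B^{-C}` (p. 28). [BakerTNT1975]
* N. I. Fel'dman, *On the measure of transcendence of the number `π`*, Izv. Akad. Nauk SSSR
  Ser. Mat. 24 (1960), 357–368 (the classical transcendence measure of `π`).
* Yu. V. Nesterenko, P. Philippon (eds.), *Introduction to Algebraic Independence Theory*,
  LNM 1752, Springer (2001), Ch. 14, Definition 2.6 and Theorem 2.7. [NesterenkoPhilippon2001]
-/

noncomputable section

namespace Summit.Schanuel.Schanuel.Theorems.RigidCore

open Polynomial
open Literature.NumberTheory.Transcendental (baker1975_thm_3_1_holds)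

namespace PiRealPowersTH

/-! ### Baker's theorem: the distance from `π` to an algebraic number -/

/-- **Transcendence measure for `π`, root form** (Baker 1975, Ch. 3, Thm 3.1 with `n = 1`,
`α₁ = -1`, `log α₁ = πi`; "`|π − β| > B^{-C}`", p. 28): for every `d ≥ 1` there is `k ∈ ℕ` such
that for every non-zero `P ∈ ℤ[X]` with `deg P ≤ d` and all `|coeff| ≤ H`, `H ≥ 1`, and every
complex root `ρ` of `P`, `(2H)^{-k} < |π − ρ|`.  (Apply Theorem 3.1 in degree `max d 2` to
`β₀ = ρ` (witness `P`) and `β₁ = i` (witness `X² + 1`) with `B = 2H`: the form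
`β₀ + β₁ πi = ρ − π` is non-zero because `π` is transcendental, so
`|ρ − π| > B^{-C} ≥ B^{-⌈C⌉}`.)
[cite: BakerTNT1975, Ch. 3 Thm 3.1 and p. 28] -/
theorem exists_rootDist_lowerBound {d : ℕ} (hd : 1 ≤ d) :
    ∃ k : ℕ, ∀ P : ℤ[X], P ≠ 0 → P.natDegree ≤ d → ∀ H : ℕ, 1 ≤ H →
      (∀ j, |P.coeff j| ≤ (H : ℤ)) → ∀ ρ : ℂ, aeval ρ P = 0 →
        (((2 * H : ℕ) : ℝ) ^ k)⁻¹ < ‖(Real.pi : ℂ) - ρ‖ := by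
  obtain ⟨C₀, -, hBaker⟩ :=
    baker1975_thm_3_1_holds.pi_case (max d 2) 1 le_rfl (le_max_of_le_left hd)
  refine ⟨⌈C₀⌉₊, fun P hP0 hPd H hH hPc ρ hρ => ?_⟩
  have hB2 : 2 ≤ 2 * H := by omega
  -- the coefficient vector `β = (ρ, i)` and its witnesses `P`, `X² + 1`
  let β : Fin 2 → ℂ := ![ρ, Complex.I]
  have hwit : ∀ j, ∃ Q : ℤ[X], Q ≠ 0 ∧ Q.natDegree ≤ max d 2 ∧
      (∀ k, |Q.coeff k| ≤ ((2 * H : ℕ) : ℤ)) ∧ aeval (β j) Q = 0 := by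
    refine Fin.forall_fin_two.mpr
      ⟨⟨P, hP0, hPd.trans (le_max_left _ _), fun k => (hPc k).trans (by push_cast; omega), ?_⟩,
        ⟨X ^ 2 + C 1, X_pow_add_C_ne_zero two_pos 1,
          by rw [natDegree_X_pow_add_C]; exact le_max_right _ _, fun k => ?_, ?_⟩⟩
    · simpa [β] using hρ
    · rw [coeff_add, coeff_X_pow, coeff_C]
      split_ifs <;> simp <;> omega
    · show aeval Complex.I (X ^ 2 + C 1 : ℤ[X]) = 0
      rw [map_add, map_pow, aeval_X, aeval_C, algebraMap_int_eq, eq_intCast, Complex.I_sq]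
      norm_num
  have hform : β 0 + ∑ i : Fin 1, β i.succ * (↑Real.pi * Complex.I) = ρ - ↑Real.pi := by
    simp only [β, Fin.sum_univ_one, Fin.succ_zero_eq_one, Matrix.cons_val_zero,
      Matrix.cons_val_one]
    rw [mul_comm (Real.pi : ℂ) Complex.I, ← mul_assoc, Complex.I_mul_I]
    ring
  rcases hBaker (2 * H) hB2 β hwit with hzero | hlb
  · -- `ρ = π` would make `π` algebraic
    exfalso
    rw [hform, sub_eq_zero] at hzero
    have halg : IsAlgebraic ℤ ρ := ⟨P, hP0, hρ⟩
    have halgQ : IsAlgebraic ℚ ρ := halg.extendScalars (algebraMap ℤ ℚ).injective_int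
    exact CalibrationR.transcendental_pi_complex (hzero ▸ halgQ)
  · rw [hform, norm_sub_rev] at hlb
    refine lt_of_le_of_lt ?_ hlb
    have hB1 : (1 : ℝ) ≤ ((2 * H : ℕ) : ℝ) := by exact_mod_cast (show 1 ≤ 2 * H by omega)
    rw [← Real.rpow_natCast, ← Real.rpow_neg (by positivity)]
    exact Real.rpow_le_rpow_of_exponent_le hB1 (neg_le_neg (Nat.le_ceil C₀))

/-! ### The transcendence measure of `π` in fixed degree -/

/-- **Transcendence measure of `π` in fixed degree** — the classical measure
`|P(π)| > H^{-C(d)}` for `0 ≠ P ∈ ℤ[X]`, `deg P ≤ d`, height `≤ H` (Baker 1975, p. 28, from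
Theorem 3.1; originally N. I. Fel'dman 1960), in the packaging consumed by
`TechnicalHypothesis.of_lowerBound`: for every `d` there are `c > 0` and `k ∈ ℕ` with
`c ≤ (∑ᵢ |hᵢ|)^k · |∑_{i<d} hᵢ πⁱ|` for every non-zero `h ∈ ℤ^d`.  Proof: with `H = ∑|hᵢ|` and
`P_h = ∑ hᵢ Xⁱ = lead · ∏_ρ (X − ρ)` over `ℂ` (at most `d` roots, `|lead| ≥ 1`), each factor
satisfies `|π − ρ| > (2H)^{-k₁}` (`exists_rootDist_lowerBound`), so `|P_h(π)| ≥ (2H)^{-k₁ d}`;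
take `k = k₁ d`, `c = 2^{-k}`.
[cite: BakerTNT1975, Ch. 3 Thm 3.1 and p. 28] -/
theorem norm_aeval_pi_lowerBound (d : ℕ) :
    ∃ c : ℝ, 0 < c ∧ ∃ k : ℕ, ∀ h : Fin d → ℤ, h ≠ 0 →
      c ≤ (∑ i, |(h i : ℝ)|) ^ k * ‖∑ i, (h i : ℂ) * (Real.pi : ℂ) ^ (i : ℕ)‖ := by
  rcases Nat.eq_zero_or_pos d with rfl | hd
  · exact ⟨1, one_pos, 0, fun h hh => (hh (Subsingleton.elim _ _)).elim⟩
  obtain ⟨k₁, hk₁⟩ := exists_rootDist_lowerBound (Nat.succ_le_of_lt hd)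
  refine ⟨((2 : ℝ) ^ (k₁ * d))⁻¹, by positivity, k₁ * d, fun h hh => ?_⟩
  set τ : ℂ := (Real.pi : ℂ) with hτ
  set P : ℤ[X] := ∑ j : Fin d, monomial (j : ℕ) (h j) with hP
  set H : ℕ := ∑ i, (h i).natAbs with hH
  have hP0 : P ≠ 0 := KernelTower.sum_monomial_ne_zero hh
  -- the height: `H = ∑ |hᵢ| ≥ 1`
  have hHZ : (H : ℤ) = ∑ i, |h i| := by
    rw [hH]; push_cast [Int.natCast_natAbs]; rfl
  have hHR : (H : ℝ) = ∑ i, |(h i : ℝ)| := by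
    have : ((H : ℤ) : ℝ) = ((∑ i, |h i| : ℤ) : ℝ) := by rw [hHZ]
    push_cast at this
    exact this
  have hH1 : 1 ≤ H := by
    obtain ⟨i, hi⟩ : ∃ i, h i ≠ 0 := Function.ne_iff.mp hh
    have h1 : 1 ≤ (h i).natAbs := Int.natAbs_pos.mpr hi
    exact h1.trans (Finset.single_le_sum (f := fun j => (h j).natAbs) (fun j _ => Nat.zero_le _)
      (Finset.mem_univ i))
  have hcoeff : ∀ j, |P.coeff j| ≤ (H : ℤ) := fun j => by
    rw [hHZ]; exact KernelTower.abs_coeff_sum_monomial_le h j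
  -- each complex root `ρ` of `P` is far from `π`
  set a : ℝ := (((2 * H : ℕ) : ℝ) ^ k₁)⁻¹ with ha
  have h2H1 : (1 : ℝ) ≤ ((2 * H : ℕ) : ℝ) := by exact_mod_cast (show 1 ≤ 2 * H by omega)
  have ha0 : 0 ≤ a := by positivity
  have ha1 : a ≤ 1 := inv_le_one_of_one_le₀ (one_le_pow₀ h2H1)
  have hroots : ∀ ρ ∈ (P.map (Int.castRingHom ℂ)).roots, a ≤ ‖τ - ρ‖ := fun ρ hρ =>
    (hk₁ P hP0 (KernelTower.natDegree_sum_monomial_le h) H hH1 hcoeff ρ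
      (KernelTower.aeval_eq_zero_of_mem_roots hρ)).le
  have hcard : (P.map (Int.castRingHom ℂ)).roots.card ≤ d :=
    (card_roots' _).trans ((natDegree_map_le).trans (KernelTower.natDegree_sum_monomial_le h))
  have hprod := KernelTower.pow_le_norm_prod_sub ha0 ha1 τ hroots hcard
  -- `|lead P| ≥ 1`
  have hlead : (1 : ℝ) ≤ ‖(P.leadingCoeff : ℂ)‖ := by
    rw [Complex.norm_intCast]
    exact_mod_cast Int.one_le_abs (leadingCoeff_ne_zero.mpr hP0)
  have hval : a ^ d ≤ ‖∑ i, (h i : ℂ) * τ ^ (i : ℕ)‖ := by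
    rw [← KernelTower.aeval_sum_monomial, KernelTower.norm_aeval_eq_mul_prod_roots]
    calc a ^ d ≤ 1 * ‖(((P.map (Int.castRingHom ℂ)).roots.map fun ρ => τ - ρ).prod)‖ := by
          rw [one_mul]; exact hprod
      _ ≤ _ := mul_le_mul_of_nonneg_right hlead (norm_nonneg _)
  -- packaging: `a^d = (2H)^{-k₁ d} = 2^{-k} H^{-k}`
  have hHpos : (0 : ℝ) < H := by exact_mod_cast hH1
  have hak : a ^ d = ((2 : ℝ) ^ (k₁ * d))⁻¹ * ((H : ℝ) ^ (k₁ * d))⁻¹ := by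
    rw [ha, Nat.cast_mul, Nat.cast_two, inv_pow, ← pow_mul, mul_pow, mul_inv]
  rw [← hHR]
  calc ((2 : ℝ) ^ (k₁ * d))⁻¹ = (H : ℝ) ^ (k₁ * d) * a ^ d := by
        rw [hak, mul_left_comm, mul_inv_cancel₀ (pow_ne_zero _ hHpos.ne'), mul_one]
    _ ≤ (H : ℝ) ^ (k₁ * d) * ‖∑ i, (h i : ℂ) * τ ^ (i : ℕ)‖ :=
        mul_le_mul_of_nonneg_left hval (pow_nonneg hHpos.le _)

/-- The powers `1, π, …, π^{d-1}` of `π` are `ℚ`-linearly independent (`π` is transcendental,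
Lindemann). [folklore] -/
theorem linearIndependent_pi_pow (d : ℕ) :
    LinearIndependent ℚ (fun i : Fin d => (Real.pi : ℂ) ^ (i : ℕ)) := by
  rw [Fintype.linearIndependent_iff]
  intro g hg l
  set p : ℚ[X] := ∑ i : Fin d, monomial (i : ℕ) (g i) with hp
  have hpt : aeval (Real.pi : ℂ) p = 0 := by
    simp only [hp, map_sum, aeval_monomial, ← Algebra.smul_def]
    exact hg
  have hp0 : p = 0 := by
    by_contra hne
    exact CalibrationR.transcendental_pi_complex ⟨p, hne, hpt⟩
  have hcoeff : p.coeff (l : ℕ) = g l := by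
    simp only [hp, finsetSum_coeff, coeff_monomial]
    rw [Finset.sum_eq_single l]
    · simp
    · intro b _ hb
      rw [if_neg]
      exact fun h => hb (Fin.ext h)
    · intro h; exact absurd (Finset.mem_univ l) h
  rw [← hcoeff, hp0, coeff_zero]

end PiRealPowersTH

/-! ## The registered stub -/

/-- **Registered stub `stub_piRealPowersTH` (C14) of line `sector-split`** (signature verbatim):
the real powers `1, π, …, π^{d-1}` satisfy the Technical Hypothesis of Nesterenko–Philippon,
LNM 1752, Ch. 14, Definition 2.6 (`∀ ε > 0 ∃ H₀ ∀ H ≥ H₀ ∀ h ∈ ℤ^d ∖ 0, |hᵢ| ≤ H ⟹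
|∑ hᵢ πⁱ| ≥ exp (−H^ε)`).  Proof: the transcendence measure
`PiRealPowersTH.norm_aeval_pi_lowerBound` (Baker 1975, Thm 3.1) is a polynomial lower bound, and
a polynomial lower bound implies (T.H.) (`TechnicalHypothesis.of_lowerBound`); the barrier's
`TechnicalHypothesis` is the tree's by `technicalHypothesis_iff_transcendental`.
[cite: BakerTNT1975, Ch. 3 Thm 3.1 and p. 28] -/
theorem stub_piRealPowersTH :
    ∀ d : ℕ, Literature.Barriers.Schanuel.TechnicalHypothesis
      (fun i : Fin d => (Real.pi : ℂ) ^ (i : ℕ)) := by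
  intro d
  obtain ⟨c, hc, k, hb⟩ := PiRealPowersTH.norm_aeval_pi_lowerBound d
  exact (Literature.Barriers.Schanuel.technicalHypothesis_iff_transcendental _).mpr
    (Literature.NumberTheory.Transcendental.TechnicalHypothesis.of_lowerBound hc (k := k) hb)

end Summit.Schanuel.Schanuel.Theorems.RigidCore

end
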